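import Summits.SmoothPoincare4.SmoothPoincare4.Theorems.EntropyRungSubcylindricalExistenceGluingConstants
import HarnessLib

/-!
# Cone capping (stub K of line `fat-conical-core-avr-logsobolev`, crux `EntropyRung.SubcylindricalExistence`):
parameter arithmetic

Pure real-variable bookkeeping for the assembly of `stub_coneCapping`: an elementary `log` bound, the
geometric grid of the cut-off family (`grid_cap`, `grid_core`, `grid_chart`), the choice of the zone
width `ℓ₀` making the cut-off cost `100 K √V₀ / Y` small (`exists_constants`), the "at most four
pieces overlap" counting bound (`sum_le_four_mul`), and the registered level arithmetic of an annulus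
piece (`helper_coneCapping_annulusLevel`).
-/

noncomputable section

set_option linter.dupNamespace false

namespace Summit.SmoothPoincare4.SmoothPoincare4.Theorems

namespace ConeCappingParams

/-- `log (c − κ) ≥ log c − 2κ/c` for `0 ≤ κ ≤ c/2`, `0 < c`. -/
theorem log_sub_ge {c κ : ℝ} (hc : 0 < c) (hκ0 : 0 ≤ κ) (hκ : κ ≤ c / 2) :
    Real.log c - 2 * (κ / c) ≤ Real.log (c - κ) := by
  have h1 : c - κ = c * (1 - κ / c) := by field_simp
  rw [h1, Real.log_mul hc.ne' (by rw [sub_ne_zero]; intro h; rw [eq_div_iff hc.ne'] at h; nlinarith)]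
  have h2 := GluingConstants.neg_two_mul_le_log_one_sub (div_nonneg hκ0 hc.le)
    (by rw [div_le_iff₀ hc]; linarith)
  linarith

/-- The grid of the capping: with `T₀ = ½ log s_J − ℓ₀` the cap piece ends exactly at `√s_J`. -/
theorem grid_cap {sJ ℓ₀ : ℝ} (hsJ : 0 < sJ) :
    Real.exp (Real.log sJ / 2 - ℓ₀ + ℓ₀) ^ 2 = sJ := by
  rw [sub_add_cancel, ← Real.exp_nat_mul]
  push_cast
  rw [show (2 : ℝ) * (Real.log sJ / 2) = Real.log sJ by ring, Real.exp_log hsJ]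

/-- The grid reaches the exact-cone region: with `N = ⌈(½ log(s_c/s_J))/ℓ₀⌉₊ + 3`,
`s_c ≤ exp (T₀ + (N − 1) ℓ₀) ^ 2`. -/
theorem grid_core {sJ sc ℓ₀ : ℝ} (hsJ : 0 < sJ) (hsJc : sJ < sc) (hℓ₀ : 1 ≤ ℓ₀) :
    sc ≤ Real.exp (Real.log sJ / 2 - ℓ₀ +
      ((⌈Real.log (sc / sJ) / 2 / ℓ₀⌉₊ + 3 : ℕ) - 1 : ℝ) * ℓ₀) ^ 2 := by
  have hsc : 0 < sc := hsJ.trans hsJc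
  have hℓ : 0 < ℓ₀ := by linarith
  set q : ℝ := Real.log (sc / sJ) / 2 / ℓ₀ with hq
  have hceil : q ≤ (⌈q⌉₊ : ℝ) := Nat.le_ceil q
  have hexp : Real.log sc / 2 ≤ Real.log sJ / 2 - ℓ₀ + ((⌈q⌉₊ + 3 : ℕ) - 1 : ℝ) * ℓ₀ := by
    have h1 : ((⌈q⌉₊ + 3 : ℕ) - 1 : ℝ) * ℓ₀ = (⌈q⌉₊ : ℝ) * ℓ₀ + 2 * ℓ₀ := by push_cast; ring
    rw [h1]
    have h2 : q * ℓ₀ ≤ (⌈q⌉₊ : ℝ) * ℓ₀ := mul_le_mul_of_nonneg_right hceil hℓ.le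
    have h3 : q * ℓ₀ = Real.log (sc / sJ) / 2 := by rw [hq]; field_simp
    have h4 : Real.log (sc / sJ) = Real.log sc - Real.log sJ := Real.log_div hsc.ne' hsJ.ne'
    nlinarith
  calc sc = Real.exp (Real.log sc / 2) ^ 2 := by
          rw [← Real.exp_nat_mul]; push_cast
          rw [show (2 : ℝ) * (Real.log sc / 2) = Real.log sc by ring, Real.exp_log hsc]
    _ ≤ _ := by
          gcongr

/-- The grid stays inside the chart with room to spare: with `s_c ≤ r² e^{−6ℓ₀−4}` one has
`exp (T₀ + (N − 1) ℓ₀ + ℓ₀ + 1) < r`. -/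
theorem grid_chart {sJ sc ℓ₀ r : ℝ} (hsJ : 0 < sJ) (hsJc : sJ < sc) (hℓ₀ : 1 ≤ ℓ₀) (hr : 0 < r)
    (hsc : sc ≤ r ^ 2 * Real.exp (-6 * ℓ₀ - 4)) :
    Real.exp (Real.log sJ / 2 - ℓ₀ +
      ((⌈Real.log (sc / sJ) / 2 / ℓ₀⌉₊ + 3 : ℕ) - 1 : ℝ) * ℓ₀ + ℓ₀ + 1) < r := by
  have hsc0 : 0 < sc := hsJ.trans hsJc
  have hℓ : 0 < ℓ₀ := by linarith
  set q : ℝ := Real.log (sc / sJ) / 2 / ℓ₀ with hq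
  have hceil : (⌈q⌉₊ : ℝ) < q + 1 := Nat.ceil_lt_add_one (by
    rw [hq]; apply div_nonneg (div_nonneg (Real.log_nonneg ?_) (by norm_num)) hℓ.le
    rw [le_div_iff₀ hsJ]; linarith)
  have hexp : Real.log sJ / 2 - ℓ₀ + ((⌈q⌉₊ + 3 : ℕ) - 1 : ℝ) * ℓ₀ + ℓ₀ + 1 ≤
      Real.log sc / 2 + 3 * ℓ₀ + 1 := by
    have h1 : ((⌈q⌉₊ + 3 : ℕ) - 1 : ℝ) * ℓ₀ = (⌈q⌉₊ : ℝ) * ℓ₀ + 2 * ℓ₀ := by push_cast; ring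
    rw [h1]
    have h2 : (⌈q⌉₊ : ℝ) * ℓ₀ ≤ (q + 1) * ℓ₀ := mul_le_mul_of_nonneg_right hceil.le hℓ.le
    have h3 : q * ℓ₀ = Real.log (sc / sJ) / 2 := by rw [hq]; field_simp
    have h4 : Real.log (sc / sJ) = Real.log sc - Real.log sJ := Real.log_div hsc0.ne' hsJ.ne'
    nlinarith
  have hlog : Real.log sc / 2 + 3 * ℓ₀ ≤ Real.log r - 2 := by
    have h1 : Real.log sc ≤ Real.log (r ^ 2 * Real.exp (-6 * ℓ₀ - 4)) := Real.log_le_log hsc0 hsc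
    rw [Real.log_mul (by positivity) (Real.exp_pos _).ne', Real.log_exp, Real.log_pow] at h1
    push_cast at h1
    linarith
  calc Real.exp _ ≤ Real.exp (Real.log r - 1) := Real.exp_le_exp.2 (by linarith)
    _ < Real.exp (Real.log r) := Real.exp_lt_exp.2 (by linarith)
    _ = r := Real.exp_log hr

/-- The choice of the zone width: given the cut-off constant `C₀`, the Sobolev constant `Y` and a
tolerance `ε'`, there are `ℓ₀ ≥ 1`, `K ≥ 4C₀/ℓ₀²`, `V₀ ≥ 2π²ℓ₀ + 1` with `1000 K √V₀ ≤ Y` and cut-off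
cost `100 K √V₀ / Y ≤ min (ε'/4) (1/2)`. -/
theorem exists_constants {C₀ Y ε' : ℝ} (hC₀ : 0 < C₀) (hY : 0 < Y) (hε' : 0 < ε') :
    ∃ ℓ₀ K V₀ : ℝ, 1 ≤ ℓ₀ ∧ 0 ≤ K ∧ 4 * C₀ / ℓ₀ ^ 2 ≤ K ∧ 0 ≤ V₀ ∧ 2 * Real.pi ^ 2 * ℓ₀ + 1 ≤ V₀ ∧
      1000 * K * Real.sqrt V₀ ≤ Y ∧ 100 * K * Real.sqrt V₀ / Y ≤ ε' / 4 ∧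
      100 * K * Real.sqrt V₀ / Y ≤ 1 / 2 := by
  set δ : ℝ := min (1 / 1000) (ε' / 400) with hδdef
  have hδpos : 0 < δ := lt_min (by norm_num) (by positivity)
  have hδ1 : δ ≤ 1 / 1000 := min_le_left _ _
  have hδ2 : δ ≤ ε' / 400 := min_le_right _ _
  set X : ℝ := 4 * C₀ * Real.sqrt (3 * Real.pi ^ 2) / (Y * δ) with hXdef
  set ℓ₀ : ℝ := X ^ 2 + 1 with hℓ₀def
  have hℓ₀ : 1 ≤ ℓ₀ := by rw [hℓ₀def]; nlinarith [sq_nonneg X]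
  have hℓ₀pos : 0 < ℓ₀ := by linarith
  set K : ℝ := 4 * C₀ / ℓ₀ ^ 2 with hKdef
  have hKpos : 0 < K := by positivity
  set V₀ : ℝ := 2 * Real.pi ^ 2 * ℓ₀ + 1 with hV₀def
  have hV₀pos : 0 < V₀ := by positivity
  have hXsq : X ≤ ℓ₀ := by rw [hℓ₀def]; nlinarith [sq_nonneg (X - 1)]
  have hV₀le : V₀ ≤ 3 * Real.pi ^ 2 * ℓ₀ := by
    rw [hV₀def]
    have : (1 : ℝ) ≤ Real.pi ^ 2 * ℓ₀ := by
      have hπ : (3 : ℝ) ≤ Real.pi := by linarith [Real.pi_gt_three]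
      nlinarith
    linarith
  have hKV : K * Real.sqrt V₀ ≤ Y * δ := by
    have h1 : Real.sqrt V₀ ≤ Real.sqrt (3 * Real.pi ^ 2) * Real.sqrt ℓ₀ := by
      rw [← Real.sqrt_mul (by positivity)]
      exact Real.sqrt_le_sqrt hV₀le
    have h2 : Real.sqrt ℓ₀ ≤ ℓ₀ := by
      rw [Real.sqrt_le_left (by linarith)]
      nlinarith
    have h3 : K * Real.sqrt V₀ ≤ 4 * C₀ * Real.sqrt (3 * Real.pi ^ 2) / ℓ₀ := by
      calc K * Real.sqrt V₀ ≤ K * (Real.sqrt (3 * Real.pi ^ 2) * ℓ₀) := by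
              apply mul_le_mul_of_nonneg_left _ hKpos.le
              exact h1.trans (mul_le_mul_of_nonneg_left h2 (Real.sqrt_nonneg _))
        _ = 4 * C₀ * Real.sqrt (3 * Real.pi ^ 2) / ℓ₀ := by
              rw [hKdef]; field_simp
    have h4 : 4 * C₀ * Real.sqrt (3 * Real.pi ^ 2) / ℓ₀ ≤ Y * δ := by
      rw [div_le_iff₀ hℓ₀pos]
      have := (div_le_iff₀ (mul_pos hY hδpos)).1 (show X ≤ ℓ₀ from hXsq)
      linarith
    exact h3.trans h4
  refine ⟨ℓ₀, K, V₀, hℓ₀, hKpos.le, le_rfl, hV₀pos.le, le_rfl, by nlinarith, ?_, ?_⟩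
  · rw [div_le_iff₀ hY]; nlinarith
  · rw [div_le_iff₀ hY]; nlinarith

/-- Counting bound: if the nonzero terms of a nonnegative family indexed by `Fin (N+1)` all have index
within `[i₀ − 1, i₀ + 2]` and each term is `≤ B`, the sum is `≤ 4B`. -/
theorem sum_le_four_mul {N : ℕ} (f : Fin (N + 1) → ℝ) (B : ℝ) (i₀ : ℕ) (hB : 0 ≤ B)
    (hle : ∀ j, f j ≤ B) (hnz : ∀ j, f j ≠ 0 → i₀ ≤ (j : ℕ) + 1 ∧ (j : ℕ) ≤ i₀ + 2) :
    ∑ j, f j ≤ 4 * B := by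
  classical
  rw [← Finset.sum_filter_ne_zero]
  set S := Finset.univ.filter (fun j : Fin (N + 1) ↦ f j ≠ 0) with hS
  have hcard : S.card ≤ 4 := by
    have h1 : S.map Fin.valEmbedding ⊆ Finset.Icc (i₀ - 1) (i₀ + 2) := by
      intro m hm
      rw [Finset.mem_map] at hm
      obtain ⟨j, hj, rfl⟩ := hm
      rw [hS, Finset.mem_filter] at hj
      have := hnz j hj.2
      simp only [Fin.valEmbedding_apply, Finset.mem_Icc]
      omega
    have h2 := Finset.card_le_card h1
    rw [Finset.card_map, Nat.card_Icc] at h2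
    omega
  calc ∑ j ∈ S, f j ≤ ∑ j ∈ S, B := Finset.sum_le_sum fun j _ ↦ hle j
    _ = S.card * B := by rw [Finset.sum_const, nsmul_eq_mul]
    _ ≤ 4 * B := by
        apply mul_le_mul_of_nonneg_right _ hB
        exact_mod_cast hcard

end ConeCappingParams

/-- Registered level arithmetic of an annulus piece of the capping (line
`fat-conical-core-avr-logsobolev`, stub K): with the assembly's choice of `κ₀`, `κ₁` the level
delivered by `helper_annulusPiece` (window `log(b/a) = 2ℓ₀`, slope `c' ≥ c − κ₁`) is at least
`3 log c − 4ε'`. -/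
theorem helper_coneCapping_annulusLevel :
    ∀ (c ε' κ₀ κ₁ ℓ₀ Y c' : ℝ), 0 < c → 0 < ε' → 0 < κ₀ → κ₀ ≤ 1 / 4 → κ₀ ≤ ε' / 4 → 0 < Y →
      1 ≤ ℓ₀ → 0 ≤ κ₁ → κ₁ ≤ ε' / (8 * (2 * ℓ₀ + 1)) → κ₁ ≤ c * ε' / 6 → κ₁ ≤ c / 2 → κ₁ ≤ 1 →
      κ₁ ≤ ε' * κ₀ * Y / (96 * Real.sqrt (2 * Real.pi ^ 2 * (2 * ℓ₀ + 1) + 1)) →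
      c - κ₁ ≤ c' →
      3 * Real.log c - 4 * ε' ≤
        3 * Real.log c' + 2 * Real.log (1 - κ₀) - 8 * (κ₁ * (2 * ℓ₀ + 1))
          - 2 * Real.log (1 + 24 * κ₁ ^ 2 * Real.sqrt (2 * Real.pi ^ 2 * (2 * ℓ₀ + 1) + 1)
              / (κ₀ * Y)) := by
  intro c ε' κ₀ κ₁ ℓ₀ Y c' hc hε' hκ₀ hκ₀a hκ₀b hY hℓ₀ hκ₁0 hκ₁a hκ₁b hκ₁c hκ₁d hκ₁e hc'
  set V : ℝ := Real.sqrt (2 * Real.pi ^ 2 * (2 * ℓ₀ + 1) + 1) with hV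
  have hVpos : 0 < V := Real.sqrt_pos.2 (by positivity)
  -- (1) `3 log c' ≥ 3 log c − ε'`
  have h1 : Real.log c - ε' / 3 ≤ Real.log c' := by
    have ha := ConeCappingParams.log_sub_ge hc hκ₁0 hκ₁c
    have hb : Real.log (c - κ₁) ≤ Real.log c' := Real.log_le_log (by linarith) hc'
    have hcc : 2 * (κ₁ / c) ≤ ε' / 3 := by
      rw [show 2 * (κ₁ / c) = 2 * κ₁ / c by ring, div_le_iff₀ hc]; linarith
    linarith
  -- (2) `2 log(1 − κ₀) ≥ −ε'`
  have h2 : -ε' ≤ 2 * Real.log (1 - κ₀) := by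
    have := GluingConstants.neg_two_mul_le_log_one_sub hκ₀.le (by linarith)
    linarith
  -- (3) `8 κ₁ (2ℓ₀+1) ≤ ε'`
  have h3 : 8 * (κ₁ * (2 * ℓ₀ + 1)) ≤ ε' := by
    have hpos : (0 : ℝ) < 8 * (2 * ℓ₀ + 1) := by positivity
    have := (le_div_iff₀ hpos).1 hκ₁a
    linarith
  -- (4) `2 log(1 + 24 κ₁² V/(κ₀Y)) ≤ ε'/2`
  have h4 : 2 * Real.log (1 + 24 * κ₁ ^ 2 * V / (κ₀ * Y)) ≤ ε' / 2 := by
    have hq : 0 ≤ 24 * κ₁ ^ 2 * V / (κ₀ * Y) := by positivity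
    have hlog : Real.log (1 + 24 * κ₁ ^ 2 * V / (κ₀ * Y)) ≤ 24 * κ₁ ^ 2 * V / (κ₀ * Y) := by
      have := Real.log_le_sub_one_of_pos (show 0 < 1 + 24 * κ₁ ^ 2 * V / (κ₀ * Y) by linarith)
      linarith
    have hbound : 24 * κ₁ ^ 2 * V / (κ₀ * Y) ≤ ε' / 4 := by
      rw [div_le_iff₀ (by positivity)]
      have he : κ₁ * (96 * V) ≤ ε' * κ₀ * Y := (le_div_iff₀ (by positivity)).1 hκ₁e
      have : 24 * κ₁ ^ 2 * V ≤ κ₁ * (24 * V) := by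
        nlinarith [mul_nonneg (mul_nonneg hκ₁0 hVpos.le) (sub_nonneg.2 hκ₁d)]
      nlinarith
    linarith
  linarith

end Summit.SmoothPoincare4.SmoothPoincare4.Theorems

end
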